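import Summits.ResolutionOfSingularities.ResolutionOfSingularities.Theorems.RisoStrataRisoCentresResolveAdjoinArcEquiv
import Summits.ResolutionOfSingularities.ResolutionOfSingularities.Theorems.RisoStrataRisoCentresResolveProductPad
import Summits.ResolutionOfSingularities.ResolutionOfSingularities.Theorems.RisoStrataRtdUpperSemicontinuous

/-!
# Crux `RisoCentresResolve` (stmt-ResolutionOfSingularities-18546), line `Sketch`

Stub `rtd_adjoin_indeterminate`: the route-level PRODUCT LEMMA for the typed riso-triviality
dimension.  Adjoining an element `u ∈ K` transcendental over the `k`-subalgebra `B ⊆ K`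
(`B' := Algebra.adjoin k (B ∪ {u}) ≅ B[X]`) raises the typed riso-triviality dimension by one at
the point `(m, u = c₀)`: `Rtd B m r → Rtd B' m' (r + 1)` for every ideal `m'` of `B'` contracting
to `m` and containing `U - c₀`.

Proof (pure assembly of landed pieces).
* `rtd_adjoin_arcEquiv`: the arcs of `B'` centred at `m'` are the pairs (arc of `B` centred at
  `m`, Hahn series `σ` of positive order), `E α' = (α' ∘ incl, α' (U - c₀))`.
* `rtd_product_pad`: the three inline clauses for the coordinates `a ↦ (a (g j))_j` of rank `≥ r`
  give the clauses for the product family `(a, σ) ↦ ((a (g j))_j, σ)` on `Fin n ⊕ Unit`, of rank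
  `≥ r + 1`.
* `fin_reindexArcs` along `E.symm` turns the product family into the arcs of `B'` with the
  coordinates `g₂ := (incl ∘ g, U - c₀) : Fin n ⊕ Unit → B'`, and `inv_reindexCoords` along
  `Fin n ⊕ Unit ≃ Fin (n + 1)` renumbers them.
* `g₂ ⊆ m'`, and `g₂` generates `B'` inside `K` (`B = k[g]` and `u = (u - c₀) + c₀`).
-/

set_option linter.dupNamespace false -- mandated namespace of this single-conjunct summit

namespace Summit.ResolutionOfSingularities.ResolutionOfSingularities.Theorems

/-- **Product lemma `Rtd B m r → Rtd B[u] m' (r + 1)`** (stub `rtd_adjoin_indeterminate` of crux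
`RisoCentresResolve`, line `Sketch`): for `u ∈ K` transcendental over the `k`-subalgebra
`B ⊆ K`, `B' = Algebra.adjoin k (B ∪ {u})`, an ideal `m'` of `B'` contracting to the ideal `m`
of `B` and containing `U - c₀` (`U = u` as an element of `B'`, `c₀ : k`), the typed
riso-triviality dimension of `B'` at `m'` is at least one more than that of `B` at `m`:
a presentation `g ⊆ m` of `B` with a straightener of rank `≥ r` yields the presentation
`(incl ∘ g, U - c₀) ⊆ m'` of `B'` with a straightener of rank `≥ r + 1`. -/
theorem rtd_adjoin_indeterminate : ∀ {k K : Type} [Field k] [Field K] [Algebra k K] (B : Subalgebra k K) (m : Ideal ↥B) (u : K) (c₀ : k), (∀ q : Polynomial ↥B, Polynomial.aeval u q = 0 → q = 0) → ∀ (hle : B ≤ Algebra.adjoin k ((B : Set K) ∪ {u})) (m' : Ideal ↥(Algebra.adjoin k ((B : Set K) ∪ {u}))) (U : ↥(Algebra.adjoin k ((B : Set K) ∪ {u}))), (U : K) = u → (∀ b : ↥B, Subalgebra.inclusion hle b ∈ m' ↔ b ∈ m) → U - algebraMap k ↥(Algebra.adjoin k ((B : Set K) ∪ {u})) c₀ ∈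 m' → ∀ r : ℕ, (∃ (n : ℕ) (g : Fin n → ↥B), (∀ i, g i ∈ m) ∧ Algebra.adjoin k (Set.range fun i => (g i : K)) = B ∧ ∃ W : Submodule k (Fin n → k), r ≤ Module.finrank k ↥W ∧ ∃ φ : {α : ↥B →ₐ[k] HahnSeries ℚ k // ∀ x ∈ m, 0 < (α x).orderTop} → (Fin n → HahnSeries ℚ k), (∀ a b : {α : ↥B →ₐ[k] HahnSeries ℚ k // ∀ x ∈ m, 0 < (α x).orderTop}, a ≠ b → ∃ j, ∀ i, (a.1 (g j) - b.1 (g j)).orderTop < ((φ a i - φ b i) - (a.1 (g i) - b.1 (g i))).orderTop) ∧ (∀ a i, 0 < (φ a i).orderTop) ∧ (∀ a, ∀ w : Fin n → HahnSeries ℚ k, (∀ i, 0 < (w i).orderTop) → w ∈ Submodule.span (HahnSeries ℚ k) ((fun u : Fin n → k => fun i => HahnSeries.C (u i)) '' (W : Set (Fin n → k))) → ∃ b, φ b = φ a + w)) → (∃ (n : ℕ) (g : Fin n → ↥(Algebra.adjoin k ((B : Set K) ∪ {u}))), (∀ i, g i ∈ m') ∧ Algebra.adjoin k (Set.range fun i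 => (g i : K)) = Algebra.adjoin k ((B : Set K) ∪ {u}) ∧ ∃ W : Submodule k (Fin n → k), r + 1 ≤ Module.finrank k ↥W ∧ ∃ φ : {α' : ↥(Algebra.adjoin k ((B : Set K) ∪ {u})) →ₐ[k] HahnSeries ℚ k // ∀ x ∈ m', 0 < (α' x).orderTop} → (Fin n → HahnSeries ℚ k), (∀ a b : {α' : ↥(Algebra.adjoin k ((B : Set K) ∪ {u})) →ₐ[k] HahnSeries ℚ k // ∀ x ∈ m', 0 < (α' x).orderTop}, a ≠ b → ∃ j, ∀ i, (a.1 (g j) - b.1 (g j)).orderTop < ((φ a i - φ b i) - (a.1 (g i) - b.1 (g i))).orderTop) ∧ (∀ a i, 0 < (φ a i).orderTop) ∧ (∀ a, ∀ w : Fin n → HahnSeries ℚ k, (∀ i, 0 < (w i).orderTop) → w ∈ Submodule.span (HahnSeries ℚ k) ((fun u : Fin n → k => fun i => HahnSeries.C (u i)) '' (W : Set (Fin n → k))) → ∃ b, φ b = φ a + w)) := by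
  intro k K _ _ _ B m u c₀ hu hle m' U hU hm' hU' r
  rintro ⟨n, g, hg, hgK, W, hW, φ, h1, h2, h3⟩
  -- (1) the presentation `g` generates `B` as a `k`-algebra
  have hgen : Algebra.adjoin k (Set.range g) = ⊤ := adjoin_range_eq_top_of_adjoin_coe_eq B g hgK
  -- (2) the arc bijection `Arc(B', m') ≃ Arc(B, m) × 𝔪`
  obtain ⟨E, hE⟩ := rtd_adjoin_arcEquiv B m u c₀ hu hle m' U hU hm' hU' ⟨n, g, hg, hgen⟩
  -- (3) the product move on the clauses, coordinates `(a (g j))_j ↦ ((a (g j))_j, σ)`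
  obtain ⟨W₁, hW₁, φ₁, k1, k2, k3⟩ :=
    rtd_product_pad
      (fun (a : {α : ↥B →ₐ[k] HahnSeries ℚ k // ∀ x ∈ m, 0 < (α x).orderTop}) (j : Fin n) =>
        a.1 (g j)) r ⟨W, hW, φ, h1, h2, h3⟩
  -- (4) the new coordinates `g₂ = (incl ∘ g, U - c₀)` on the arcs of `B'`, reindexed along `E`
  obtain ⟨g₂, hg₂l, hg₂r⟩ : ∃ g₂ : Fin n ⊕ Unit → ↥(Algebra.adjoin k ((B : Set K) ∪ {u})),
      (∀ j, g₂ (Sum.inl j) = Subalgebra.inclusion hle (g j)) ∧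
      (∀ v, g₂ (Sum.inr v) = U - algebraMap k ↥(Algebra.adjoin k ((B : Set K) ∪ {u})) c₀) :=
    ⟨fun j => Sum.elim (fun j => Subalgebra.inclusion hle (g j))
      (fun _ => U - algebraMap k ↥(Algebra.adjoin k ((B : Set K) ∪ {u})) c₀) j,
      fun j => rfl, fun v => rfl⟩
  obtain ⟨W₂, hW₂, φ₂, l1, l2, l3⟩ := fin_reindexArcs E.symm
    (fun (x : {α : ↥B →ₐ[k] HahnSeries ℚ k // ∀ x ∈ m, 0 < (α x).orderTop} ×
        {s : HahnSeries ℚ k // 0 < s.orderTop}) (j : Fin n ⊕ Unit) =>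
      Sum.elim ((fun (a : {α : ↥B →ₐ[k] HahnSeries ℚ k // ∀ x ∈ m, 0 < (α x).orderTop})
        (j : Fin n) => a.1 (g j)) x.1) (fun _ : Unit => x.2.1) j)
    (fun (a' : {α' : ↥(Algebra.adjoin k ((B : Set K) ∪ {u})) →ₐ[k] HahnSeries ℚ k //
        ∀ x ∈ m', 0 < (α' x).orderTop}) (j : Fin n ⊕ Unit) => a'.1 (g₂ j))
    (by
      intro x j
      beta_reduce
      obtain ⟨h1E, h2E⟩ := hE (E.symm x)
      rw [Equiv.apply_symm_apply] at h1E h2E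
      rcases j with j | j
      · rw [hg₂l, Sum.elim_inl, h1E, AlgHom.comp_apply]
      · rw [hg₂r, Sum.elim_inr, h2E])
    (r + 1) ⟨W₁, hW₁, φ₁, k1, k2, k3⟩
  -- (5) renumber the coordinates along `Fin n ⊕ Unit ≃ Fin (n + 1)`
  obtain ⟨eI⟩ : Nonempty (Fin n ⊕ Unit ≃ Fin (n + 1)) :=
    ⟨(Equiv.sumCongr (Equiv.refl (Fin n)) finOneEquiv.symm).trans finSumFinEquiv⟩
  have h₅ := inv_reindexCoords eI
    (fun (a' : {α' : ↥(Algebra.adjoin k ((B : Set K) ∪ {u})) →ₐ[k] HahnSeries ℚ k //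
        ∀ x ∈ m', 0 < (α' x).orderTop}) (j : Fin n ⊕ Unit) => a'.1 (g₂ j))
    (r + 1) ⟨W₂, hW₂, φ₂, l1, l2, l3⟩
  -- (6) membership in `m'` and generation inside `K`
  have hg₂m : ∀ j, g₂ j ∈ m' := by
    rintro (j | j)
    · rw [hg₂l]
      exact (hm' (g j)).mpr (hg j)
    · rw [hg₂r]
      exact hU'
  refine ⟨n + 1, fun i => g₂ (eI.symm i), fun i => hg₂m _, ?_, h₅⟩
  apply le_antisymm
  · rw [Algebra.adjoin_le_iff]
    rintro _ ⟨i, rfl⟩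
    exact (g₂ (eI.symm i)).2
  · rw [Algebra.adjoin_le_iff]
    rintro x (hx | hx)
    · rw [← hgK] at hx
      refine Algebra.adjoin_mono ?_ hx
      rintro _ ⟨j, rfl⟩
      refine ⟨eI (Sum.inl j), ?_⟩
      beta_reduce
      rw [Equiv.symm_apply_apply, hg₂l, Subalgebra.coe_inclusion]
    · rw [Set.mem_singleton_iff] at hx
      have hxeq : x = ((g₂ (eI.symm (eI (Sum.inr ())))) : K) + algebraMap k K c₀ := by
        rw [hx, Equiv.symm_apply_apply, hg₂r, Subalgebra.coe_sub, Subalgebra.coe_algebraMap, hU,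
          sub_add_cancel]
      rw [SetLike.mem_coe, hxeq]
      exact add_mem (Algebra.subset_adjoin ⟨eI (Sum.inr ()), rfl⟩)
        (Subalgebra.algebraMap_mem _ c₀)

end Summit.ResolutionOfSingularities.ResolutionOfSingularities.Theorems
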